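/-
Copyright (c) 2026 the pub-hodgecm-mathlib formalisation cell (harness21).  Prover seat hodgecm-mathlib-K2Liu-p06 (g3): Track B «K2-LIT»,
hLiu418 = stmt-HodgeConjecture-24832, director req649 (S1) ∕ LEAD F0P6-plan (g11) deal of record 2026-09-04T05:23:13Z = organ Φ1 of ROAD Φ
(ruling «M-155l» §2; CENSUS-41 row Φ1): the EXPANSION file (B) — HEAD of Φ1; 2026-09-04.
-/
import Summits.HodgeConjecture.HodgeConjecture.Theorems.K2LiuSiegelFourierCoeffDelta      -- ★ (A2) (+ (A1) injectivity ∕ separation, `unipDeltaChar_*`)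
import Literature.Analysis.Fourier.InversionCompactQuotient                              -- ★ abstract inversion on a compact abelian group
import HarnessLib

/-!
# Crux `HLiu418`, ROAD Φ, organ Φ1 (B): THE FOURIER EXPANSION ALONG `N_Δ(L⁺)\N_Δ(𝔸)` — `φ(u h) = Σ_S φ_S(h) ψ_S(u)`

Cell `hodgecm-mathlib`, crux item hLiu418 = `stmt-HodgeConjecture-24832`, route `HCCMUnconditional`; squad K2 ∕ K2Liu, LEAD F0P6-plan (g11 → g12), deal req649
(S1) (memo `F0/P6/F0P6-plan-g11/DEALS-req649-S1S2S3.v1.F0P6-plan-g11.md` §(S1); CENSUS-41 row Φ1), prover K2Liu-p06 (g3).  THEOREMS ONLY (no `def`,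
no instance, no notation, no named-fact hypothesis, no `sorry`); lane `--supports stmt-HodgeConjecture-24832 --as helper` (count-neutral).

THE THEOREM (**`hasSum_fourierCoeffDelta_mul_unipDeltaChar`**).  Non-degenerate doubled datum (`dV i, dW j ≠ 0`); `νN` a left-invariant measure on
`N_Δ(𝔸) = ↥unipDelta`, `β` an `N_Δ(L⁺)`-covering weight with `0 < ∫ β dνN < ∞` (★ `K2LiuUnipotentCoveringWeight`); `φ : H(𝔸) → ℂ` and `h ∈ H(𝔸)` with
`u ↦ φ(u h)` CONTINUOUS on `N_Δ(𝔸)` and LEFT-`N_Δ(L⁺)`-INVARIANT; and the Fourier coefficients `φ_S(h) = fourierCoeffDelta νN β S φ h` (★ (D)) ABSOLUTELY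
SUMMABLE over the index group `S ∈ Skew_{T_L}(L) = skewMatrices c (gramR ⊗ L)` (★ (D); `≅ Herm_n(L)`).  THEN for every `u₀ ∈ N_Δ(𝔸)`

  `φ(u₀ h) = Σ_{S ∈ Skew_{T_L}(L)} φ_S(h) · ψ_S(u₀)`   (`HasSum`),

in particular (**`hasSum_fourierCoeffDelta`**, `u₀ = 1`) `φ(h) = Σ_S φ_S(h)`.  This is the Fourier expansion of an automorphic form along the abelian
unipotent radical `N_Δ ≅ Herm_n` of the Siegel parabolic [MoeglinWaldspurger1995, I.2.6], [Shimura1997, §18.1 (18.5)], [Tan1999, §3], [KudlaRallis1994, §2];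
the absolute summability is the «smooth enough» hypothesis (for `K`-finite Eisenstein series it follows from the decay of `φ_S` in `S`, organs Φ5∕Φ6∕Φ9).

PROOF (no Haar uniqueness, no quotient measure).  `C := Skew_T(𝔸_L) ⧸ Skew_T(𝔸_L)_{rat}` (rational points) is a compact abelian group (★
`K2LiuUnipotentCocompact.exists_isCompact_cover_unipDelta` through the chart ★ `K2LiuUnipotentChart.exists_unipChart`); the NORMALISED PUSH-FORWARD
`μ := (∫β)⁻¹ • (mk ∘ X)_*(β • νN)` of the weighted Haar measure IS an invariant probability measure of full support on `C` (invariance = left-invariance of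
`νN` + ★ weight independence `lintegral_mul_eq_of_coveringSum_eq`; full support = Mathlib `isOpenPosMeasure_of_addLeftInvariant_of_compact`); the characters
`χ_S([X]) = ψ_L(tr(S_𝔸 X))`, `S ∈ Skew_{T_L}(L)`, form an injective separating group of continuous characters of `C` (★ (A1)
`eq_zero_of_forall_unipDeltaChar_eq_one`, `exists_map_eq_of_forall_unipDeltaChar_eq_one`); `φ(· h)` descends to a continuous `G` on `C` whose `μ`-coefficients
ARE the `φ_S(h)` (Mathlib `integral_map`, `integral_withDensity_eq_integral_toReal_smul`); conclude by the abstract pointwise inversion theorem ★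
`Literature.Analysis.Fourier.hasSum_integral_conj_addChar_mul_mul` (Tate's Lemma 4.2.2: completeness of characters by Stone–Weierstrass).
[CasselsFrohlichANT1967, Ch. XV Lemma 4.2.2].

HONEST LABEL.  Count-neutral helper; `HC_CM` is proved only modulo the 7 printed citations (2 remaining named inputs: hLiu418 = `stmt-HodgeConjecture-24832`,
h413 = `stmt-HodgeConjecture-24833`) until rung 0 closes.
-/

set_option autoImplicit false
set_option linter.dupNamespace false -- the mandated namespace repeats `HodgeConjecture.HodgeConjecture`

noncomputable section

open scoped Matrix ENNReal NNReal ComplexConjugate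
open NumberField IsDedekindDomain MeasureTheory MeasureTheory.Measure Filter Set Function
open Literature.NumberTheory.Automorphic Literature.NumberTheory.Automorphic.UnitaryGroup Literature.NumberTheory.GaloisRepresentations
open Literature.NumberTheory.GelbartRogawski1991 Literature.NumberTheory.GelbartRogawski1991.GRConstruction
open Literature.NumberTheory.K2Lit.SiegelDoubled Literature.MeasureTheory.Group

namespace Summit.HodgeConjecture.HodgeConjecture.Cruxes.HLiu418.K2LiuSiegelFourierExpansionDelta

open K2LiuSiegelUnipotentFourierDefs K2LiuSiegelUnipotentCharacters K2LiuSiegelFourierCoeffDelta K2LiuUnipotentChart K2LiuUnipotentCocompact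
  K2LiuSiegelDoubledLeviMatrix K2LiuSiegelDoubledRationalPoints K2LiuUnipotentCoveringWeight
open Literature.NumberTheory.Automorphic.DoubledUnitary.RankOneReduction (mem_range_toAdelic_iff)

/-! ## §1 Characters of a quotient -/

/-- **A character trivial on a subgroup descends to the quotient** (`V` abelian): for `ψ ∈ Â` with `ψ|_Γ = 1` there is `χ ∈ (V⧸Γ)^` with `χ ∘ mk = ψ`
(Mathlib `QuotientAddGroup.lift` through `AddChar.toAddMonoidHomEquiv`). [folklore] -/
theorem exists_addChar_quotient_apply {V : Type*} [AddCommGroup V] (Γ : AddSubgroup V) (ψ : AddChar V Circle) (hψ : ∀ x ∈ Γ, ψ x = 1) :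
    ∃ χ : AddChar (V ⧸ Γ) Circle, ∀ x, χ (QuotientAddGroup.mk x) = ψ x := by
  refine ⟨AddChar.toAddMonoidHomEquiv.symm (QuotientAddGroup.lift Γ (AddChar.toAddMonoidHomEquiv ψ) fun x hx => ?_), fun x => ?_⟩
  · rw [AddMonoidHom.mem_ker, AddChar.toAddMonoidHomEquiv_apply, hψ x hx]
    rfl
  · rw [AddChar.toAddMonoidHomEquiv_symm_apply, QuotientAddGroup.lift_mk, AddChar.toAddMonoidHomEquiv_apply]
    rfl

variable (L : Type) [Field L] [NumberField L] [IsCMField L]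
variable {N M n : ℕ} (e : Fin N × Fin M ≃ Fin n)
  (dV : Fin N → L) (hdV : ∀ i, IsCMField.complexConj L (dV i) = dV i)
  (dW : Fin M → L) (hdW : ∀ i, IsCMField.complexConj L (dW i) = dW i)
variable [MeasurableSpace (unipDelta L e dV hdV dW hdW)] [BorelSpace (unipDelta L e dV hdV dW hdW)]

/-! ## §2 The expansion -/

set_option maxHeartbeats 400000 in
-- one long LINEAR construction (quotient group, push-forward measure, character family, descent) in a single declaration; no search-heavy automation
/-- **THE FOURIER EXPANSION ALONG `N_Δ(L⁺)\N_Δ(𝔸)`: `φ(u₀ h) = Σ_{S ∈ Skew_{T_L}(L)} φ_S(h) · ψ_S(u₀)`** for `u ↦ φ(u h)` continuous and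
left-`N_Δ(L⁺)`-invariant on `N_Δ(𝔸)` with absolutely summable coefficients `φ_S(h) = fourierCoeffDelta νN β S φ h` (`νN` left-invariant, `β` an
`N_Δ(L⁺)`-covering weight, `0 < ∫β < ∞`; non-degenerate datum). [cite: MoeglinWaldspurger1995, I.2.6] [cite: Shimura1997, §18.1] [cite: Tan1999, §3]
[cite: CasselsFrohlichANT1967, Ch. XV Lemma 4.2.2] -/
theorem hasSum_fourierCoeffDelta_mul_unipDeltaChar (hdV0 : ∀ i, dV i ≠ 0) (hdW0 : ∀ i, dW i ≠ 0)
    (νN : Measure (unipDelta L e dV hdV dW hdW)) [νN.IsMulLeftInvariant]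
    {β : unipDelta L e dV hdV dW hdW → ℝ≥0∞} (hβ : IsCoveringWeight (unipDeltaRat L e dV hdV dW hdW) β)
    (hβ0 : ∫⁻ u, β u ∂νN ≠ 0) (hβtop : ∫⁻ u, β u ∂νN ≠ ∞)
    {φ : HA L e dV hdV dW hdW → ℂ} {h : HA L e dV hdV dW hdW} (hφc : Continuous fun u : unipDelta L e dV hdV dW hdW => φ ((u : HA L e dV hdV dW hdW) * h))
    (hφ : ∀ (γ : unipDeltaRat L e dV hdV dW hdW) (u : unipDelta L e dV hdV dW hdW),
      φ ((((γ : unipDelta L e dV hdV dW hdW) * u : unipDelta L e dV hdV dW hdW) : HA L e dV hdV dW hdW) * h) = φ ((u : HA L e dV hdV dW hdW) * h))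
    (hsum : Summable fun S : skewMatrices ((IsCMField.complexConj L : L ≃ₐ[Fp L] L) : L →+* L) ((gramR L e dV hdV dW hdW).map (algebraMap (Fp L) L)) =>
      ‖fourierCoeffDelta L e dV hdV dW hdW νN β (S : Matrix (Fin n) (Fin n) L) φ h‖)
    (u₀ : unipDelta L e dV hdV dW hdW) :
    HasSum (fun S : skewMatrices ((IsCMField.complexConj L : L ≃ₐ[Fp L] L) : L →+* L) ((gramR L e dV hdV dW hdW).map (algebraMap (Fp L) L)) =>
        fourierCoeffDelta L e dV hdV dW hdW νN β (S : Matrix (Fin n) (Fin n) L) φ h *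
          (unipDeltaChar L e dV hdV dW hdW (S : Matrix (Fin n) (Fin n) L) (u₀ : HA L e dV hdV dW hdW) : ℂ))
      (φ ((u₀ : HA L e dV hdV dW hdW) * h)) := by
  classical
  -- ### the data: `σ`, `T`, `T_L`, the index group `Ξ`
  set σ := conjAdele (Fp L) L (IsCMField.complexConj L) with hσdef
  set T : Matrix (Fin n) (Fin n) (AdeleRing (𝓞 L) L) :=
    (gramR L e dV hdV dW hdW).map ((algebraMap L (AdeleRing (𝓞 L) L)).comp (algebraMap (Fp L) L)) with hTdef
  set Ξ : AddSubgroup (Matrix (Fin n) (Fin n) L) :=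
    skewMatrices ((IsCMField.complexConj L : L ≃ₐ[Fp L] L) : L →+* L) ((gramR L e dV hdV dW hdW).map (algebraMap (Fp L) L)) with hΞdef
  haveI : Countable L := NumberField.countable' (K := L)
  haveI : Countable (Matrix (Fin n) (Fin n) L) := inferInstanceAs (Countable (Fin n → Fin n → L))
  haveI : Countable Ξ := Subtype.countable
  haveI : Countable (unipDeltaRat L e dV hdV dW hdW) := countable_unipDeltaRat L e dV hdV dW hdW
  haveI : MeasurableConstSMul (unipDeltaRat L e dV hdV dW hdW) (unipDelta L e dV hdV dW hdW) :=
    ⟨fun γ => measurable_const_mul (γ : unipDelta L e dV hdV dW hdW)⟩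
  haveI : SMulInvariantMeasure (unipDeltaRat L e dV hdV dW hdW) (unipDelta L e dV hdV dW hdW) νN :=
    ⟨fun γ s _hs => measure_preimage_mul νN (γ : unipDelta L e dV hdV dW hdW) s⟩
  -- ### the coordinate group `V = Skew_T(𝔸_L)`, its rational points `ΓV`, the quotient `C`
  set V : AddSubgroup (Matrix (Fin n) (Fin n) (AdeleRing (𝓞 L) L)) := skewMatrices σ T with hVdef
  set ΓV : AddSubgroup V :=
    (AddMonoidHom.range ((algebraMap L (AdeleRing (𝓞 L) L)).mapMatrix : Matrix (Fin n) (Fin n) L →+* Matrix (Fin n) (Fin n) (AdeleRing (𝓞 L) L)).toAddMonoidHom).comap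
      V.subtype with hΓVdef
  have hmemΓV : ∀ X : V, X ∈ ΓV ↔ ∃ X₀ : Matrix (Fin n) (Fin n) L, X₀.map (algebraMap L (AdeleRing (𝓞 L) L)) = (X : Matrix (Fin n) (Fin n) (AdeleRing (𝓞 L) L)) := by
    intro X
    rw [hΓVdef, AddSubgroup.mem_comap, AddMonoidHom.mem_range]
    rfl
  -- the coordinate of `u ∈ N_Δ(𝔸)` as an element of `V`
  set Xv : unipDelta L e dV hdV dW hdW → V := fun u =>
    ⟨(blk L e dV hdV dW hdW (u : HA L e dV hdV dW hdW)).toBlocks₁₂, skew_of_mem_unipDelta L e dV hdV dW hdW u.2⟩ with hXvdef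
  have hXvc : Continuous Xv := ((continuous_toBlocks₁₂_blk L e dV hdV dW hdW).comp continuous_subtype_val).subtype_mk _
  have hXv_mul : ∀ u v : unipDelta L e dV hdV dW hdW, Xv (u * v) = Xv u + Xv v := fun u v =>
    Subtype.ext (by simp only [hXvdef, Subgroup.coe_mul, AddSubgroup.coe_add]; exact toBlocks₁₂_blk_mul L e dV hdV dW hdW u.2 v.2)
  have hXv_rat : ∀ γ : unipDeltaRat L e dV hdV dW hdW, Xv (γ : unipDelta L e dV hdV dW hdW) ∈ ΓV := by
    intro γ
    obtain ⟨X₀, hX₀⟩ := exists_toBlocks₁₂_blk_eq_map_of_mem_ratH L e dV hdV dW hdW ((mem_unipDeltaRat_iff L e dV hdV dW hdW _).1 γ.2)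
    exact (hmemΓV _).2 ⟨X₀, hX₀.symm⟩
  -- ### the chart `ch : V → N_Δ(𝔸)`
  obtain ⟨φc, hφcc, hφadd, hφmem, hφsurj, hφrat⟩ := exists_unipChart L e dV hdV dW hdW
  set ch : V → unipDelta L e dV hdV dW hdW := fun X => ⟨⟨φc X, (hφmem X X.2).choose⟩, (hφmem X X.2).choose_spec.1⟩ with hchdef
  have hchc : Continuous ch := ((hφcc.comp continuous_subtype_val).subtype_mk _).subtype_mk _
  have hch_coord : ∀ X : V, Xv (ch X) = X := by
    intro X
    refine Subtype.ext ?_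
    have hf := (hφmem X X.2).choose_spec.2
    have h1 := (mem_unipDelta_iff_conj L e dV hdV dW hdW _).1 (hφmem X X.2).choose_spec.1
    rw [hf] at h1
    have h12 := congrArg Matrix.toBlocks₁₂ h1
    rw [Matrix.toBlocks_fromBlocks₁₂, Matrix.toBlocks_fromBlocks₁₂] at h12
    exact h12.symm
  have hch_Xv : ∀ u : unipDelta L e dV hdV dW hdW, ch (Xv u) = u := fun u =>
    Subtype.ext (Subtype.ext (hφsurj (u : HA L e dV hdV dW hdW) u.2))
  have hch_add : ∀ X Y : V, ch (X + Y) = ch X * ch Y := fun X Y =>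
    Subtype.ext (Subtype.ext (by simp only [hchdef, AddSubgroup.coe_add, Subgroup.coe_mul]; exact hφadd _ _))
  have hch_rat : ∀ X : V, X ∈ ΓV → ch X ∈ unipDeltaRat L e dV hdV dW hdW := by
    intro X hX
    obtain ⟨X₀, hX₀⟩ := (hmemΓV X).1 hX
    refine (mem_unipDeltaRat_iff L e dV hdV dW hdW _).2 ((mem_range_toAdelic_iff (Fp L) L (IsCMField.complexConj L) (hermD L e dV hdV dW hdW) _).2 ?_)
    show φc (X : Matrix (Fin n) (Fin n) (AdeleRing (𝓞 L) L)) ∈ _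
    rw [← hX₀]
    exact hφrat X₀
  -- ### the quotient `C` and its structure
  haveI : CompactSpace (V ⧸ ΓV) := by
    obtain ⟨K, hK, hcover⟩ := exists_isCompact_cover_unipDelta L e dV hdV dW hdW hdV0 hdW0
    refine ⟨?_⟩
    have hsurj : (QuotientAddGroup.mk ∘ Xv) '' K = (Set.univ : Set (V ⧸ ΓV)) := by
      refine Set.eq_univ_of_forall fun c => ?_
      induction c using QuotientAddGroup.induction_on with
      | H X =>
        obtain ⟨γ, hγ⟩ := hcover (ch X)
        refine ⟨γ • ch X, hγ, ?_⟩
        show QuotientAddGroup.mk (Xv ((γ : unipDelta L e dV hdV dW hdW) * ch X)) = QuotientAddGroup.mk X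
        rw [hXv_mul, hch_coord, QuotientAddGroup.eq_iff_sub_mem, add_sub_cancel_right]
        exact hXv_rat γ
    rw [← hsurj]
    exact hK.image ((QuotientAddGroup.continuous_mk (N := ΓV)).comp hXvc)
  letI : MeasurableSpace (V ⧸ ΓV) := borel _
  haveI : BorelSpace (V ⧸ ΓV) := ⟨rfl⟩
  -- the projection `π : N_Δ(𝔸) → C`, a continuous homomorphism killing `N_Δ(L⁺)` and onto
  set π : unipDelta L e dV hdV dW hdW → V ⧸ ΓV := fun u => QuotientAddGroup.mk (Xv u) with hπdef
  have hπc : Continuous π := (QuotientAddGroup.continuous_mk (N := ΓV)).comp hXvc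
  have hπm : Measurable π := hπc.measurable
  have hπ_mul : ∀ u v : unipDelta L e dV hdV dW hdW, π (u * v) = π u + π v := fun u v => by
    simp only [hπdef, hXv_mul, QuotientAddGroup.mk_add]
  have hπ_rat : ∀ (γ : unipDeltaRat L e dV hdV dW hdW) (u : unipDelta L e dV hdV dW hdW), π (γ • u) = π u := fun γ u => by
    have h0 : π (γ : unipDelta L e dV hdV dW hdW) = 0 := (QuotientAddGroup.eq_zero_iff _).2 (hXv_rat γ)
    rw [smul_eq_coe_mul, hπ_mul, h0, zero_add]
  have hπ_ch : ∀ X : V, π (ch X) = QuotientAddGroup.mk X := fun X => by simp only [hπdef, hch_coord]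
  -- ### the push-forward probability measure `μ`
  set μ : Measure (V ⧸ ΓV) := (∫⁻ u, β u ∂νN)⁻¹ • Measure.map π (νN.withDensity β) with hμdef
  have hμA : ∀ A : Set (V ⧸ ΓV), MeasurableSet A → μ A = (∫⁻ u, β u ∂νN)⁻¹ * ∫⁻ u, A.indicator (fun _ => (1 : ℝ≥0∞)) (π u) * β u ∂νN := by
    intro A hA
    rw [hμdef, Measure.smul_apply, smul_eq_mul, Measure.map_apply hπm hA, withDensity_apply _ (hπm hA), ← lintegral_indicator (hπm hA)]
    congr 1
    refine lintegral_congr fun u => ?_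
    by_cases hu : π u ∈ A
    · rw [Set.indicator_of_mem (show u ∈ π ⁻¹' A from hu), Set.indicator_of_mem hu, one_mul]
    · rw [Set.indicator_of_notMem (show u ∉ π ⁻¹' A from hu), Set.indicator_of_notMem hu, zero_mul]
  haveI : IsProbabilityMeasure μ := ⟨by
    rw [hμA _ MeasurableSet.univ]
    simp only [Set.indicator_univ, one_mul]
    exact ENNReal.inv_mul_cancel hβ0 hβtop⟩
  haveI : μ.IsAddLeftInvariant := by
    refine ⟨fun c => Measure.ext fun s hs => ?_⟩
    rw [Measure.map_apply (measurable_const_add c) hs, hμA _ (measurable_const_add c hs), hμA _ hs]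
    congr 1
    induction c using QuotientAddGroup.induction_on with
    | H X =>
      set u₁ : unipDelta L e dV hdV dW hdW := ch X with hu₁
      have hF : Measurable fun v : unipDelta L e dV hdV dW hdW => s.indicator (fun _ => (1 : ℝ≥0∞)) (π v) :=
        (measurable_const.indicator hs).comp hπm
      have hFinv : ∀ (γ : unipDeltaRat L e dV hdV dW hdW) (v : unipDelta L e dV hdV dW hdW),
          s.indicator (fun _ => (1 : ℝ≥0∞)) (π (γ • v)) = s.indicator (fun _ => (1 : ℝ≥0∞)) (π v) := fun γ v => by rw [hπ_rat]
      have hβ' := isCoveringWeight_comp_mul_left L e dV hdV dW hdW hβ u₁⁻¹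
      calc ∫⁻ u, ((fun x => QuotientAddGroup.mk X + x) ⁻¹' s).indicator (fun _ => (1 : ℝ≥0∞)) (π u) * β u ∂νN
          = ∫⁻ u, s.indicator (fun _ => (1 : ℝ≥0∞)) (π (u₁ * u)) * β (u₁⁻¹ * (u₁ * u)) ∂νN := by
            refine lintegral_congr fun u => ?_
            rw [inv_mul_cancel_left, hπ_mul, hπ_ch]
            rfl
        _ = ∫⁻ u, s.indicator (fun _ => (1 : ℝ≥0∞)) (π u) * β (u₁⁻¹ * u) ∂νN :=
            lintegral_mul_left_eq_self (fun v => s.indicator (fun _ => (1 : ℝ≥0∞)) (π v) * β (u₁⁻¹ * v)) u₁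
        _ = ∫⁻ u, s.indicator (fun _ => (1 : ℝ≥0∞)) (π u) * β u ∂νN :=
            lintegral_mul_eq_of_coveringSum_eq νN hF hFinv hβ'.1 hβ.1 one_ne_zero ENNReal.one_ne_top hβ'.2 hβ.2
  haveI : μ.IsOpenPosMeasure := isOpenPosMeasure_of_addLeftInvariant_of_compact (μ := μ) Set.univ isCompact_univ (by
    rw [measure_univ]; exact one_ne_zero)
  -- ### the character family `χ : Ξ →+ (V ⧸ ΓV)^`
  set ψV : Matrix (Fin n) (Fin n) L → AddChar V Circle := fun S =>
    { toFun := fun X => adeleAddChar L (S.map (algebraMap L (AdeleRing (𝓞 L) L)) * (X : Matrix (Fin n) (Fin n) (AdeleRing (𝓞 L) L))).trace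
      map_zero_eq_one' := by simp only [ZeroMemClass.coe_zero, Matrix.mul_zero, Matrix.trace_zero, AddChar.map_zero_eq_one]
      map_add_eq_mul' := fun X Y => by simp only [AddSubgroup.coe_add, Matrix.mul_add, Matrix.trace_add, AddChar.map_add_eq_mul] } with hψVdef
  have hψV_apply : ∀ S (X : V), ψV S X = adeleAddChar L (S.map (algebraMap L (AdeleRing (𝓞 L) L)) * (X : Matrix (Fin n) (Fin n) (AdeleRing (𝓞 L) L))).trace :=
    fun S X => rfl
  have hψV_Xv : ∀ S (u : unipDelta L e dV hdV dW hdW), ψV S (Xv u) = unipDeltaChar L e dV hdV dW hdW S (u : HA L e dV hdV dW hdW) := fun S u => rfl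
  have hψV_kill : ∀ S, ∀ X ∈ ΓV, ψV S X = 1 := by
    intro S X hX
    rw [← hch_coord X, hψV_Xv]
    exact unipDeltaChar_eq_one_of_mem_ratH L e dV hdV dW hdW S ((mem_unipDeltaRat_iff L e dV hdV dW hdW _).1 (hch_rat X hX))
  choose χ hχ using fun S : Matrix (Fin n) (Fin n) L => exists_addChar_quotient_apply ΓV (ψV S) (hψV_kill S)
  have hχπ : ∀ S (u : unipDelta L e dV hdV dW hdW), χ S (π u) = unipDeltaChar L e dV hdV dW hdW S (u : HA L e dV hdV dW hdW) := fun S u => by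
    rw [hπdef]; exact (hχ S (Xv u)).trans (hψV_Xv S u)
  set χh : Ξ →+ AddChar (V ⧸ ΓV) Circle :=
    { toFun := fun S => χ (S : Matrix (Fin n) (Fin n) L)
      map_zero' := by
        refine AddChar.ext _ _ fun c => ?_
        induction c using QuotientAddGroup.induction_on with
        | H X => rw [ZeroMemClass.coe_zero, hχ, hψV_apply, Matrix.map_zero _ (map_zero _), Matrix.zero_mul, Matrix.trace_zero, AddChar.map_zero_eq_one]; rfl
      map_add' := fun S S' => by
        refine AddChar.ext _ _ fun c => ?_
        induction c using QuotientAddGroup.induction_on with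
        | H X => rw [AddChar.add_apply, AddSubgroup.coe_add, hχ, hχ, hχ, hψV_apply, hψV_apply, hψV_apply, Matrix.map_add _ (map_add _), Matrix.add_mul,
            Matrix.trace_add, AddChar.map_add_eq_mul] } with hχhdef
  have hχh_apply : ∀ (S : Ξ) (c : V ⧸ ΓV), χh S c = χ (S : Matrix (Fin n) (Fin n) L) c := fun S c => rfl
  -- continuity
  have hχc : ∀ S : Ξ, Continuous fun c : V ⧸ ΓV => (χh S c : ℂ) := by
    intro S
    rw [(QuotientAddGroup.isQuotientMap_mk ΓV).continuous_iff]
    have h1 : ((fun c : V ⧸ ΓV => (χh S c : ℂ)) ∘ QuotientAddGroup.mk) = fun X : V => (ψV (S : Matrix (Fin n) (Fin n) L) X : ℂ) := by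
      funext X; simp only [Function.comp_apply, hχh_apply, hχ]
    rw [h1]
    refine continuous_subtype_val.comp ((continuous_adeleAddChar L).comp ?_)
    have h2 : Continuous fun X : V => (S : Matrix (Fin n) (Fin n) L).map (algebraMap L (AdeleRing (𝓞 L) L)) * (X : Matrix (Fin n) (Fin n) (AdeleRing (𝓞 L) L)) :=
      continuous_const.matrix_mul continuous_subtype_val
    exact continuous_finsetSum _ fun i _ => (continuous_apply i).comp ((continuous_apply i).comp h2)
  -- injectivity (★ (A1) INJECTIVITY)
  have hχi : Function.Injective χh := by
    intro S S' hSS'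
    have h1 : ∀ u : HA L e dV hdV dW hdW, u ∈ unipDelta L e dV hdV dW hdW →
        unipDeltaChar L e dV hdV dW hdW ((S : Matrix (Fin n) (Fin n) L) - (S' : Matrix (Fin n) (Fin n) L)) u = 1 := by
      intro u hu
      have h2 := DFunLike.congr_fun hSS' (π ⟨u, hu⟩)
      rw [hχh_apply, hχh_apply, hχπ, hχπ] at h2
      rw [sub_eq_add_neg, unipDeltaChar_add, unipDeltaChar_neg, h2, mul_inv_cancel]
    have h3 := eq_zero_of_forall_unipDeltaChar_eq_one L e dV hdV dW hdW hdV0 hdW0 (Ξ.sub_mem S.2 S'.2) h1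
    exact Subtype.ext (sub_eq_zero.1 h3)
  -- separation (★ (A1) SEPARATION)
  have hχs : ∀ c : V ⧸ ΓV, c ≠ 0 → ∃ S : Ξ, χh S c ≠ 1 := by
    intro c hc
    by_contra hall
    push Not at hall
    apply hc
    induction c using QuotientAddGroup.induction_on with
    | H X =>
      have h1 : ∀ S ∈ Ξ, unipDeltaChar L e dV hdV dW hdW S ((ch X : unipDelta L e dV hdV dW hdW) : HA L e dV hdV dW hdW) = 1 := by
        intro S hS
        have h2 := hall ⟨S, hS⟩
        rwa [hχh_apply, ← hπ_ch, hχπ] at h2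
      obtain ⟨X₀, -, hX₀⟩ := exists_map_eq_of_forall_unipDeltaChar_eq_one L e dV hdV dW hdW hdV0 hdW0 (ch X).2 h1
      have hXΓ : X ∈ ΓV := by
        refine (hmemΓV X).2 ⟨X₀, ?_⟩
        have h3 := congrArg (fun Y : V => (Y : Matrix (Fin n) (Fin n) (AdeleRing (𝓞 L) L))) (hch_coord X)
        simp only [hXvdef] at h3
        rw [← h3, hX₀]
      exact (QuotientAddGroup.eq_zero_iff X).2 hXΓ
  -- ### the descended function `G`
  set G : V ⧸ ΓV → ℂ := Quotient.lift (s := QuotientAddGroup.leftRel ΓV)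
    (fun X : V => φ (((ch X : unipDelta L e dV hdV dW hdW) : HA L e dV hdV dW hdW) * h)) (fun a b hab => by
      have hmem : -a + b ∈ ΓV := QuotientAddGroup.leftRel_apply.1 hab
      have hb : b = a + (-a + b) := by abel
      show φ (((ch a : unipDelta L e dV hdV dW hdW) : HA L e dV hdV dW hdW) * h) = φ (((ch b : unipDelta L e dV hdV dW hdW) : HA L e dV hdV dW hdW) * h)
      have hcomm : ch a * ch (-a + b) = ch (-a + b) * ch a := Subtype.ext (mul_comm_of_mem_unipDelta L e dV hdV dW hdW (ch a).2 (ch (-a + b)).2)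
      rw [hb, hch_add, hcomm]
      exact (hφ ⟨ch (-a + b), hch_rat _ hmem⟩ (ch a)).symm) with hGdef
  have hGmk : ∀ X : V, G (QuotientAddGroup.mk X) = φ (((ch X : unipDelta L e dV hdV dW hdW) : HA L e dV hdV dW hdW) * h) := fun X => rfl
  have hGπ : ∀ u : unipDelta L e dV hdV dW hdW, G (π u) = φ ((u : HA L e dV hdV dW hdW) * h) := fun u => by
    rw [hπdef]
    show G (QuotientAddGroup.mk (Xv u)) = _
    rw [hGmk, hch_Xv]
  have hGc : Continuous G := by
    rw [(QuotientAddGroup.isQuotientMap_mk ΓV).continuous_iff]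
    have h1 : (G ∘ QuotientAddGroup.mk) = fun X : V => φ (((ch X : unipDelta L e dV hdV dW hdW) : HA L e dV hdV dW hdW) * h) := funext hGmk
    rw [h1]
    exact hφc.comp hchc
  -- ### the `μ`-coefficients of `G` are the `φ_S(h)`
  have hcoeff : ∀ S : Ξ, ∫ c, conj (χh S c : ℂ) * G c ∂μ = fourierCoeffDelta L e dV hdV dW hdW νN β (S : Matrix (Fin n) (Fin n) L) φ h := by
    intro S
    have hgc : Continuous fun c : V ⧸ ΓV => conj (χh S c : ℂ) * G c := (Complex.continuous_conj.comp (hχc S)).mul hGc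
    rw [hμdef, integral_smul_measure, integral_map hπm.aemeasurable hgc.aestronglyMeasurable,
      integral_withDensity_eq_integral_toReal_smul hβ.1 (ae_of_all _ fun u => lt_of_le_of_lt (hβ.le_one u) ENNReal.one_lt_top),
      fourierCoeffDelta_def, ENNReal.toReal_inv]
    congr 1
    refine integral_congr_ae (ae_of_all _ fun u => ?_)
    simp only [hχh_apply, hχπ, hGπ]
  -- ### conclude by the abstract inversion theorem
  have hsum' : Summable fun S : Ξ => ‖∫ c, conj (χh S c : ℂ) * G c ∂μ‖ := by
    simp_rw [hcoeff]; exact hsum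
  have key := Literature.Analysis.Fourier.hasSum_integral_conj_addChar_mul_mul μ χh hχi hχc hχs hGc hsum' (π u₀)
  rw [hGπ] at key
  refine key.congr_fun fun S => ?_
  rw [hcoeff, hχh_apply, hχπ]

/-- **`φ(h) = Σ_S φ_S(h)`** (the expansion at `u₀ = 1`, `HasSum` form). [cite: MoeglinWaldspurger1995, I.2.6] [cite: Shimura1997, §18.1] -/
theorem hasSum_fourierCoeffDelta (hdV0 : ∀ i, dV i ≠ 0) (hdW0 : ∀ i, dW i ≠ 0)
    (νN : Measure (unipDelta L e dV hdV dW hdW)) [νN.IsMulLeftInvariant]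
    {β : unipDelta L e dV hdV dW hdW → ℝ≥0∞} (hβ : IsCoveringWeight (unipDeltaRat L e dV hdV dW hdW) β)
    (hβ0 : ∫⁻ u, β u ∂νN ≠ 0) (hβtop : ∫⁻ u, β u ∂νN ≠ ∞)
    {φ : HA L e dV hdV dW hdW → ℂ} {h : HA L e dV hdV dW hdW} (hφc : Continuous fun u : unipDelta L e dV hdV dW hdW => φ ((u : HA L e dV hdV dW hdW) * h))
    (hφ : ∀ (γ : unipDeltaRat L e dV hdV dW hdW) (u : unipDelta L e dV hdV dW hdW),
      φ ((((γ : unipDelta L e dV hdV dW hdW) * u : unipDelta L e dV hdV dW hdW) : HA L e dV hdV dW hdW) * h) = φ ((u : HA L e dV hdV dW hdW) * h))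
    (hsum : Summable fun S : skewMatrices ((IsCMField.complexConj L : L ≃ₐ[Fp L] L) : L →+* L) ((gramR L e dV hdV dW hdW).map (algebraMap (Fp L) L)) =>
      ‖fourierCoeffDelta L e dV hdV dW hdW νN β (S : Matrix (Fin n) (Fin n) L) φ h‖) :
    HasSum (fun S : skewMatrices ((IsCMField.complexConj L : L ≃ₐ[Fp L] L) : L →+* L) ((gramR L e dV hdV dW hdW).map (algebraMap (Fp L) L)) =>
        fourierCoeffDelta L e dV hdV dW hdW νN β (S : Matrix (Fin n) (Fin n) L) φ h) (φ h) := by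
  have key := hasSum_fourierCoeffDelta_mul_unipDeltaChar L e dV hdV dW hdW hdV0 hdW0 νN hβ hβ0 hβtop hφc hφ hsum 1
  rw [OneMemClass.coe_one, one_mul] at key
  refine key.congr_fun fun S => ?_
  rw [unipDeltaChar_one, Circle.coe_one, mul_one]

/-- **`φ(h) = Σ'_S φ_S(h)`** (`tsum` form). [cite: MoeglinWaldspurger1995, I.2.6] [cite: Shimura1997, §18.1] -/
theorem eq_tsum_fourierCoeffDelta (hdV0 : ∀ i, dV i ≠ 0) (hdW0 : ∀ i, dW i ≠ 0)
    (νN : Measure (unipDelta L e dV hdV dW hdW)) [νN.IsMulLeftInvariant]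
    {β : unipDelta L e dV hdV dW hdW → ℝ≥0∞} (hβ : IsCoveringWeight (unipDeltaRat L e dV hdV dW hdW) β)
    (hβ0 : ∫⁻ u, β u ∂νN ≠ 0) (hβtop : ∫⁻ u, β u ∂νN ≠ ∞)
    {φ : HA L e dV hdV dW hdW → ℂ} {h : HA L e dV hdV dW hdW} (hφc : Continuous fun u : unipDelta L e dV hdV dW hdW => φ ((u : HA L e dV hdV dW hdW) * h))
    (hφ : ∀ (γ : unipDeltaRat L e dV hdV dW hdW) (u : unipDelta L e dV hdV dW hdW),
      φ ((((γ : unipDelta L e dV hdV dW hdW) * u : unipDelta L e dV hdV dW hdW) : HA L e dV hdV dW hdW) * h) = φ ((u : HA L e dV hdV dW hdW) * h))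
    (hsum : Summable fun S : skewMatrices ((IsCMField.complexConj L : L ≃ₐ[Fp L] L) : L →+* L) ((gramR L e dV hdV dW hdW).map (algebraMap (Fp L) L)) =>
      ‖fourierCoeffDelta L e dV hdV dW hdW νN β (S : Matrix (Fin n) (Fin n) L) φ h‖) :
    φ h = ∑' S : skewMatrices ((IsCMField.complexConj L : L ≃ₐ[Fp L] L) : L →+* L) ((gramR L e dV hdV dW hdW).map (algebraMap (Fp L) L)),
        fourierCoeffDelta L e dV hdV dW hdW νN β (S : Matrix (Fin n) (Fin n) L) φ h :=
  (hasSum_fourierCoeffDelta L e dV hdV dW hdW hdV0 hdW0 νN hβ hβ0 hβtop hφc hφ hsum).tsum_eq.symm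

end Summit.HodgeConjecture.HodgeConjecture.Cruxes.HLiu418.K2LiuSiegelFourierExpansionDelta

end
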